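import Mathlib.Algebra.Module.Torsion.Basic
import Mathlib.RepresentationTheory.Basic
import Mathlib.NumberTheory.NumberField.InfinitePlace.TotallyRealComplex
import Literature.NumberTheory.DiophantineGeometry.AVIsogenyTate
import Literature.NumberTheory.GaloisRepresentations.ModPGaloisRep
import Literature.AlgebraicGeometry.Motives.GoodReduction
import HarnessLib

/-!
# Hilbert–Blumenthal abelian varieties, their `𝔞`-torsion Galois modules, and the twisted
# full-level-`𝔞` (level-3) moduli problem `X^{ρ̄}`

Vocabulary of Ellenberg, *Serre's conjecture over `𝔽₉`*, Ann. of Math. 161 (2005), §§1–2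
(= arXiv:math/0107147), built on the tree's abelian varieties
(`Literature.AlgebraicGeometry.Motives.AbelianVariety`: a proper geometrically integral group
scheme over a field `K`, `End A` a ring via `Preadditive`, `A.dim`, geometric points
`A.geomPoints = A(K̄)` with their `Γ_K`-action, `AbelianVariety.Hom.geomPointsMap`).

* `HilbertBlumenthalAV K F` — a **Hilbert–Blumenthal abelian variety** (HBAV) over the field `K`
  with real multiplication by `𝓞 = 𝓞_F`, `F` a totally real number field: an abelian variety
  `A / K` of dimension `[F : ℚ]` with an injective ring homomorphism `𝓞_F → End(A)`
  (Ellenberg §1, first paragraph: "an abelian `d`-fold endowed with an injection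
  `𝓞 ↪ End(A)`, where `𝓞` is the ring of integers of a totally real number field of degree `d`";
  Rapoport's definition). For `F = ℚ(√5)` these are the RM abelian surfaces of Ellenberg,
  Shepherd-Barron–Taylor.
* the `𝓞_F`-module structure on `A(K̄)` (`a • P = (rm a)(P)`), commuting with `Γ_K`
  (endomorphisms are defined over `K`), the **`𝔞`-torsion** `A[𝔞] = A.torsionAt 𝔞 ⊆ A(K̄)`
  for an ideal `𝔞 ⊆ 𝓞_F` (Mathlib `Submodule.torsionBySet`, an `𝓞_F ⧸ 𝔞`-module by Mathlib's
  instance), its `Γ_K`-stability, and the **`𝔞`-torsion representation**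
  `A.torsionRep 𝔞 : Representation (𝓞_F ⧸ 𝔞) Γ_K A[𝔞]` (Ellenberg §1: "`A[𝔭]` as a
  two-dimensional `𝓞/𝔭𝓞`-module" with its Galois action; for `F = ℚ(√5)`, `𝔞 = (3)` inert,
  `𝓞/3 ≅ 𝔽₉`, this is `ρ̄_{A,3} : Γ_K → GL₂(𝔽₉)`, and `𝔞 = (√5)` gives
  `ρ̄_{A,√5} : Γ_K → GL₂(𝔽₅)`).
* `ModPGaloisRep.HasCyclotomicDet ρ̄ p ι` — the hypothesis `det ρ̄ = χ̄_p` of Ellenberg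
  Prop. 1.3 and of the definition of `X^{ρ̄}` (tree's `modPCyclotomicCharacter`).
* `HilbertBlumenthalAV.LevelStructure A 𝔞 e ρ̄` — a **full level-`𝔞` structure of type `ρ̄`**
  on `A`: an isomorphism `ι : A[𝔞] ≅ V_{ρ̄}` of `Γ_K`-modules which is `𝓞_F/𝔞`-semilinear along
  a chosen identification `e : 𝓞_F ⧸ 𝔞 ≃+* k` of coefficient fields, where `V_{ρ̄} = k²` with
  `Γ_K` acting through `ρ̄ : Γ_K → GL₂(k)` (Ellenberg, Notation: "`V_{ρ̄}` the Galois module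
  `𝔽₉ ⊕ 𝔽₉` with Galois acting by `ρ̄`"; §2: "`ι : A[3] ≅ V_{ρ̄}` an isomorphism of
  [`𝓞`-module] group schemes").
* `HilbertBlumenthalLevelModuli K F 𝔞 e ρ̄` — the `K`-valued points of the **twisted
  full-level-`𝔞` moduli problem**: pairs `(A, ι)`; and the requested notion
  `HilbertBlumenthalLevelThreeModuli K F e ρ̄ := HilbertBlumenthalLevelModuli K F (3) e ρ̄`,
  Ellenberg's `X^{ρ̄}(K)` (§2, "pairs `(A, ι)` where `A` is a [generalized] HBAV and
  `ι : A[3] ≅ V_{ρ̄}`").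
* `ModPGaloisRep.IsDistinguishedAt ρ̄ v` — Ellenberg's Def. 1.1: `ρ̄ : Γ_K → GL₂(k)` is
  **`D_v`-distinguished** if in some frame `ρ̄|_{D_v}` is upper triangular with *distinct*
  diagonal characters (for `k` algebraically closed, as in Def. 1.1, this is exactly
  "`(ρ̄|_{D_v})^{ss} ≅ θ₁ ⊕ θ₂` with `θ₁ ≠ θ₂`": a plane representation whose Jordan–Hölder
  factors are characters has an invariant line). `D_v` is the image of
  `absGaloisRestrict K K_v`, the convention of the tree's `IsPDistinguishedAt`.
* `HilbertBlumenthalAV.HasGoodReductionAt A v` — good reduction at a finite place of a number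
  field, the tree's `Literature.AlgebraicGeometry.Motives.HasGoodReductionAt A.X A.dim v`
  (smooth proper model over `𝓞_{K,v}`; Serre–Tate §1).

## What is deliberately NOT here (and why)

* The **symplectic condition** `∧² ι = id` of Ellenberg §2 (the Weil pairing on `A[3]` versus
  the standard symplectic form on `V_{ρ̄}`, using `∧² V_{ρ̄} ≅ μ₃ ⊗ 𝓞` from `det ρ̄ = χ̄₃`):
  the tree has no Weil pairing / polarisations for abelian varieties (only for Weierstrass
  curves, `Literature.NumberTheory.EllipticCurves.WeilPairing`). So `LevelStructure` is the
  `𝓞`-linear, `Γ_K`-equivariant level structure WITHOUT the pairing condition, and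
  `HilbertBlumenthalLevelThreeModuli K F e ρ̄` is the set of `K`-points of the (finite disjoint)
  union of the twists `X^{ρ̄, λ}` over the possible values `λ` of `∧² ι`; every point of
  Ellenberg's `X^{ρ̄}(K)` is a point here, and the Galois-module conclusion "`A[3] ≅ ρ̄|_{Γ_K}`"
  that the route `EvenIcosahedralCM` consumes is exactly membership here. This is WIDER than
  `X^{ρ̄}` and is flagged as such in every docstring concerned.
* Cusps / generalized (semi-abelian) HBAVs of the proper model `𝒳^{ρ̄} / ℤ[1/N]`, its
  representability and properness, and the van der Geer–Hirzebruch birational model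
  `σ₁ = σ₂ = σ₄ = 0 ⊂ ℙ⁵` (Ellenberg Lemma 2.1): the projective model is the separate,
  purely algebraic file `LevelThreeHilbertModularSurfaceModel`; representability needs the
  moduli functor on all `ℤ[1/N]`-schemes (abelian schemes over general bases), absent.
* Good *ordinary* and *multiplicative* reduction of abelian varieties (Ellenberg Prop. 1.2,
  Prop. 1.3) need the special fibre of a Néron / abelian-scheme model as a group scheme; they
  are set up for general abelian varieties in a separate file, not specialised here.
* The Deligne–Pappas condition and Rapoport's local freeness of `Lie(A)` over `𝓞 ⊗ K`
  (automatic in characteristic `0`, the only case used by Ellenberg) are not imposed.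

## Design notes

* `F` (the totally real field) is a parameter with `[NumberField F] [IsTotallyReal F]`, and the
  real multiplication is by the full ring of integers `𝓞 F` (Mathlib
  `NumberField.RingOfIntegers`), exactly as printed; `dim_eq : A.dim = [F : ℚ]`.
* The `𝓞 F`-module structure on `A.geomPoints` is `Module.compHom` along the ring
  homomorphism `End A → AddMonoid.End A(K̄)`, `f ↦ geomPointsMap f` (`endToGeomPointsEnd`;
  multiplicativity is `geomPointsMap_comp`, additivity `geomPointsMap_add`, all proved in
  `AVIsogenyTate`), composed with `rm`. `SMulCommClass Γ_K (𝓞 F) A(K̄)` is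
  `geomPointsMap_smul` (equivariance of `K`-endomorphisms).
* `ρ̄` is a `ModPGaloisRep K k 2 = Γ_K →ₜ* GL (Fin 2) k` of the tree (take the discrete
  topology on a finite `k`); `V_{ρ̄}` is `Fin 2 → k` with `FramedRep.toRepresentation ρ̄`
  (`σ ↦ (ρ̄ σ) *ᵥ ·`). The coefficient identification `e : 𝓞 F ⧸ 𝔞 ≃+* k` is explicit data
  (for `F = ℚ(√5)`, `𝔞 = (3)`: an isomorphism `𝓞/3 ≅ 𝔽₉`, of which there are two).
* Mathlib / Literature searched (`lean search`): no `HilbertBlumenthal`, `RealMultiplication`,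
  `HilbertModular`, level structures or `Distinguished` for mod-`p` representations; reused:
  `Submodule.torsionBySet` (+ its `Module (R ⧸ I)` instance, `torsionBySet.mk_smul`),
  `Module.compHom`, `AddMonoid.End.applyModule`, `Function.Injective.distribMulAction`,
  `Representation.ofDistribMulAction`, `NumberField.IsTotallyReal`, `CategoryTheory.End`.

## References

* J. S. Ellenberg, *Serre's conjecture over `𝔽₉`*, Ann. of Math. 161 (2005), 1111–1142,
  §1 (HBAV, Def. 1.1, Prop. 1.2, Prop. 1.3), §2 (the moduli problem `X^{ρ̄}`, Lemma 2.1).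
  [Ellenberg2005]
* N. Shepherd-Barron, R. Taylor, *Mod 2 and mod 5 icosahedral representations*, JAMS 10
  (1997), §1 (RM abelian surfaces by `ℤ[(1+√5)/2]`, `A[√5]`, `A[2]`). [ShepherdBarronTaylor1997]
* D. Mumford, *Abelian Varieties*, §19 (endomorphisms act on points and on torsion).
  [MumfordAV1970]
* J.-P. Serre, J. Tate, *Good reduction of abelian varieties*, Ann. of Math. 88 (1968), §1.
  [SerreTate1968]
-/

noncomputable section

universe u v w

open CategoryTheory IsDedekindDomain
open scoped NumberField
open Literature.AlgebraicGeometry.Motives (AbelianVariety)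
open Literature.AlgebraicGeometry.Motives.AbelianVariety (geomPoints)
open Literature.AlgebraicGeometry.Motives.AbelianVariety.Hom
open Literature.NumberTheory.GaloisRepresentations

namespace Literature.NumberTheory.DiophantineGeometry

/-! ### Hilbert–Blumenthal abelian varieties -/

/-- A **Hilbert–Blumenthal abelian variety** (HBAV) over the field `K` with real multiplication
by the ring of integers `𝓞 F` of the totally real number field `F`: an abelian variety `A / K`
of dimension `d = [F : ℚ]` together with an *injective* ring homomorphism
`rm : 𝓞 F → End(A)` ("an abelian `d`-fold endowed with an injection `𝓞 ↪ End(A)`, where `𝓞` is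
the ring of integers of a totally real number field of degree `d` over `ℚ`").
For `F = ℚ(√5)` (`𝓞 F = ℤ[(1+√5)/2]`, `d = 2`) these are the RM abelian surfaces of
Shepherd-Barron–Taylor and Ellenberg. The Deligne–Pappas / Rapoport conditions on `Lie(A)` are
not part of this definition (automatic over fields of characteristic `0`).
[cite: Ellenberg2005, §1 (first paragraph)] -/
structure HilbertBlumenthalAV (K : Type u) [Field K] (F : Type v) [Field F] [NumberField F]
    [NumberField.IsTotallyReal F] extends AbelianVariety K where
  /-- The real multiplication `𝓞 F → End(A)`, a ring homomorphism. -/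
  rm : 𝓞 F →+* End toAbelianVariety
  /-- The real multiplication is injective (`𝓞 ↪ End(A)`). -/
  rm_injective : Function.Injective rm
  /-- `dim A = [F : ℚ]`. -/
  dim_eq : toAbelianVariety.dim = Module.finrank ℚ F

namespace HilbertBlumenthalAV

variable {K : Type u} [Field K] {F : Type v} [Field F] [NumberField F] [NumberField.IsTotallyReal F]
variable (A : HilbertBlumenthalAV K F)

/-- The dimension of an HBAV with real multiplication by `𝓞 F` is the degree `[F : ℚ]`, which is
also the `ℤ`-rank of `𝓞 F` (Mathlib `NumberField.RingOfIntegers.rank`). [folklore] -/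
theorem dim_eq_finrank_ringOfIntegers : A.dim = Module.finrank ℤ (𝓞 F) := by
  rw [A.dim_eq, NumberField.RingOfIntegers.rank]

/-! ### The `𝓞 F`-module `A(K̄)` -/

/-- Endomorphisms act on geometric points: the ring homomorphism `End(A) → End(A(K̄))`,
`f ↦ (P ↦ f(P))` (`AbelianVariety.Hom.geomPointsMap`). Multiplicativity is functoriality
`geomPointsMap_comp` (composition in `End A` is `f * g = g ≫ f`, as in `End(A(K̄))`), additivity
is `geomPointsMap_add` (Mumford, *Abelian Varieties*, §19: `End(X)` acts on `X` and on its
points). [cite: MumfordAV1970, §19] -/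
def endToGeomPointsEnd : End A.toAbelianVariety →+* AddMonoid.End A.geomPoints where
  toFun f := geomPointsMap f
  map_one' := by
    rw [End.one_def, geomPointsMap_id]
    rfl
  map_mul' f g := by
    rw [End.mul_def, geomPointsMap_comp]
    rfl
  map_zero' := geomPointsMap_zero
  map_add' := geomPointsMap_add

/-- `endToGeomPointsEnd f` is `geomPointsMap f`. [folklore] -/
@[simp]
theorem endToGeomPointsEnd_apply (f : End A.toAbelianVariety) (P : A.geomPoints) :
    A.endToGeomPointsEnd f P = geomPointsMap f P := rfl

/-- The **`𝓞 F`-module structure on `A(K̄)`** given by real multiplication: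
`a • P = (rm a)(P)` (Mathlib `Module.compHom` of the tautological `AddMonoid.End`-module
structure along `endToGeomPointsEnd ∘ rm`; Ellenberg §1: "`A[𝔭]` as an `𝓞/𝔭𝓞`-module, where
`𝓞` is the ring of real multiplications"). [cite: Ellenberg2005, §1 (proof of Prop. 1.2)] -/
instance instModuleRingOfIntegersGeomPoints : Module (𝓞 F) A.geomPoints :=
  Module.compHom A.geomPoints (A.endToGeomPointsEnd.comp A.rm)

/-- Unfolding the real-multiplication action on points: `a • P = geomPointsMap (rm a) P`. [folklore] -/
theorem rm_smul_def (a : 𝓞 F) (P : A.geomPoints) : a • P = geomPointsMap (A.rm a) P := rfl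

/-- The Galois action commutes with real multiplication on `A(K̄)`: `σ • (a • P) = a • (σ • P)`,
because endomorphisms of `A` are defined over `K` (`geomPointsMap_smul`; Mumford §19, p. 176;
Serre–Tate §1). [cite: SerreTate1968, §1] -/
instance instSMulCommClassGaloisRingOfIntegers :
    SMulCommClass (Field.absoluteGaloisGroup K) (𝓞 F) A.geomPoints where
  smul_comm σ a P := by
    rw [rm_smul_def, rm_smul_def, geomPointsMap_smul]

/-! ### `𝔞`-torsion and the `𝔞`-torsion Galois representation -/

/-- The **`𝔞`-torsion** `A[𝔞] = {P ∈ A(K̄) | a • P = 0 for all a ∈ 𝔞}` of an HBAV, for an ideal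
`𝔞 ⊆ 𝓞 F`, as an `𝓞 F`-submodule of `A(K̄)` (Mathlib `Submodule.torsionBySet`; it is an
`𝓞 F ⧸ 𝔞`-module by Mathlib's instance). For `F = ℚ(√5)`: `A[3]` (`𝔞 = (3)`, an
`𝓞/3 ≅ 𝔽₉`-plane) and `A[√5]` (`𝔞 = (√5)`, an `𝔽₅`-plane) of Ellenberg and
Shepherd-Barron–Taylor. An `abbrev`, so that Mathlib's `Module (𝓞 F ⧸ 𝔞)` instance on
`torsionBySet` applies. [cite: Ellenberg2005, §1 (proof of Prop. 1.2) and §2] -/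
abbrev torsionAt (𝔞 : Ideal (𝓞 F)) : Submodule (𝓞 F) A.geomPoints :=
  Submodule.torsionBySet (𝓞 F) A.geomPoints 𝔞

variable {A}

/-- Membership in `A[𝔞]`: `P ∈ A[𝔞] ↔ ∀ a ∈ 𝔞, a • P = 0`. [folklore] -/
theorem mem_torsionAt_iff {𝔞 : Ideal (𝓞 F)} {P : A.geomPoints} :
    P ∈ A.torsionAt 𝔞 ↔ ∀ a ∈ 𝔞, a • P = 0 := by
  rw [Submodule.mem_torsionBySet_iff]
  exact ⟨fun h a ha => h ⟨a, ha⟩, fun h a => h a.1 a.2⟩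

/-- `A[𝔞]` is contained in the `n`-torsion `A(K̄)[n]` for every integer `n ∈ 𝔞` (e.g.
`A[𝔭] ⊆ A[p]` for `𝔭 ∣ p`): `n • P = (rm n)(P) = 0` since `rm` is a ring homomorphism. [folklore] -/
theorem mem_geomTorsion_of_mem_torsionAt {𝔞 : Ideal (𝓞 F)} {P : A.geomPoints}
    (hP : P ∈ A.torsionAt 𝔞) {n : ℤ} (hn : (n : 𝓞 F) ∈ 𝔞) : P ∈ A.geomTorsion n := by
  rw [AbelianVariety.mem_geomTorsion_iff']
  have h := mem_torsionAt_iff.mp hP (n : 𝓞 F) hn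
  rwa [← Int.cast_smul_eq_zsmul (𝓞 F)]

/-- `A[𝔞]` is `Γ_K`-stable: real multiplications commute with `Γ_K`. [cite: Ellenberg2005, §1] -/
theorem smul_mem_torsionAt {𝔞 : Ideal (𝓞 F)} (σ : Field.absoluteGaloisGroup K) {P : A.geomPoints}
    (hP : P ∈ A.torsionAt 𝔞) : σ • P ∈ A.torsionAt 𝔞 := by
  rw [mem_torsionAt_iff] at hP ⊢
  intro a ha
  rw [← smul_comm σ a P, hP a ha, smul_zero]

variable (A)

/-- The `Γ_K`-action on `A[𝔞]` (restriction of the action on `A(K̄)`). [folklore] -/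
instance instSMulGaloisTorsionAt (𝔞 : Ideal (𝓞 F)) :
    SMul (Field.absoluteGaloisGroup K) (A.torsionAt 𝔞) :=
  ⟨fun σ P => ⟨σ • (P : A.geomPoints), smul_mem_torsionAt σ P.2⟩⟩

variable {A} in
/-- The `Γ_K`-action on `A[𝔞]` is the restriction of the action on `A(K̄)`. [folklore] -/
@[simp]
theorem coe_galois_smul {𝔞 : Ideal (𝓞 F)} (σ : Field.absoluteGaloisGroup K) (P : A.torsionAt 𝔞) :
    ((σ • P : A.torsionAt 𝔞) : A.geomPoints) = σ • (P : A.geomPoints) := rfl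

/-- `Γ_K` acts on `A[𝔞]` by group automorphisms (restriction of the action on `A(K̄)`; Mathlib
`Function.Injective.distribMulAction` along the inclusion). [folklore] -/
instance instDistribMulActionGaloisTorsionAt (𝔞 : Ideal (𝓞 F)) :
    DistribMulAction (Field.absoluteGaloisGroup K) (A.torsionAt 𝔞) :=
  Function.Injective.distribMulAction (A.torsionAt 𝔞).subtype.toAddMonoidHom
    Subtype.val_injective (fun _ _ => rfl)

/-- The `Γ_K`-action on `A[𝔞]` is `𝓞 F ⧸ 𝔞`-linear (it commutes with real multiplication). [cite: Ellenberg2005, §1] -/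
instance instSMulCommClassGaloisQuotientTorsionAt (𝔞 : Ideal (𝓞 F)) :
    SMulCommClass (Field.absoluteGaloisGroup K) (𝓞 F ⧸ 𝔞) (A.torsionAt 𝔞) where
  smul_comm σ c P := by
    obtain ⟨b, rfl⟩ := Ideal.Quotient.mk_surjective c
    apply Subtype.ext
    rw [Submodule.torsionBySet.mk_smul, Submodule.torsionBySet.mk_smul]
    change σ • (b • (P : A.geomPoints)) = b • (σ • (P : A.geomPoints))
    exact smul_comm σ b (P : A.geomPoints)

/-- The **`𝔞`-torsion Galois representation** `ρ̄_{A,𝔞} : Γ_K → GL_{𝓞/𝔞}(A[𝔞])`, as an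
`𝓞 F ⧸ 𝔞`-linear representation of `Γ_K` on `A[𝔞]` (Mathlib `Representation.ofDistribMulAction`).
For `F = ℚ(√5)`, `𝔞 = (3)`: Ellenberg's `Γ_K → GL₂(𝔽₉)` on `A[3]`; `𝔞 = (√5)`:
`ρ̄_{A,√5} : Γ_K → GL₂(𝔽₅)`. (That `A[𝔭]` is `2`-dimensional over `𝓞/𝔭` is a theorem about
HBAVs, not recorded here; a `LevelStructure` exhibits it.) [cite: Ellenberg2005, §1 and §3 (proof of Thm. 3.2)] -/
def torsionRep (𝔞 : Ideal (𝓞 F)) :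
    Representation (𝓞 F ⧸ 𝔞) (Field.absoluteGaloisGroup K) (A.torsionAt 𝔞) :=
  Representation.ofDistribMulAction (𝓞 F ⧸ 𝔞) (Field.absoluteGaloisGroup K) (A.torsionAt 𝔞)

variable {A} in
/-- Unfolding `torsionRep`: `ρ̄_{A,𝔞}(σ) P = σ • P`. [folklore] -/
@[simp]
theorem torsionRep_apply_apply {𝔞 : Ideal (𝓞 F)} (σ : Field.absoluteGaloisGroup K)
    (P : A.torsionAt 𝔞) : A.torsionRep 𝔞 σ P = σ • P := rfl

end HilbertBlumenthalAV

/-! ### `det ρ̄ = χ̄_p` -/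

/-- The hypothesis **`det ρ̄ = χ̄_p`** on a mod `p` representation `ρ̄ : Γ_K → GL₂(k)`: the
determinant is the mod `p` cyclotomic character, compared inside `k` through the embedding
`ι : 𝔽_p → k` (tree's `modPCyclotomicCharacter K k p ι`). This is the standing hypothesis of
Ellenberg Prop. 1.3 and of the definition of `X^{ρ̄}` (§2: "the determinant condition on `ρ̄`
yields `∧² V_{ρ̄} ≅ μ₃ ⊗ 𝓞`"). [cite: Ellenberg2005, Prop. 1.3] -/
def _root_.Literature.NumberTheory.GaloisRepresentations.ModPGaloisRep.HasCyclotomicDet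
    {K : Type u} [Field K] {k : Type w} [Field k] [TopologicalSpace k] [IsTopologicalRing k]
    (ρ : ModPGaloisRep K k 2) (p : ℕ) [Fact p.Prime] [NeZero (p : K)] (ι : ZMod p →+* k) :
    Prop :=
  ∀ σ : Field.absoluteGaloisGroup K,
    (Matrix.GeneralLinearGroup.det (ρ σ) : k) = (modPCyclotomicCharacter K k p ι σ : k)

/-! ### Level structures of type `ρ̄` and the twisted moduli problem -/

namespace HilbertBlumenthalAV

variable {K : Type u} [Field K] {F : Type v} [Field F] [NumberField F] [NumberField.IsTotallyReal F]
variable {k : Type w} [Field k] [TopologicalSpace k]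

/-- A **full level-`𝔞` structure of type `ρ̄`** on the HBAV `A / K`: an isomorphism of abelian
groups `ι : A[𝔞] ≃ V_{ρ̄} = k²` which is `𝓞 F ⧸ 𝔞`-semilinear along the identification
`e : 𝓞 F ⧸ 𝔞 ≃+* k` of coefficient fields (`map_smul`; so `𝔞` is a maximal ideal with residue
field `≅ k`, e.g. `𝔞 = (3) ⊂ ℤ[(1+√5)/2]`, `k = 𝔽₉`) and `Γ_K`-equivariant for `Γ_K` acting on
`k²` through `ρ̄` (`map_galois`, `FramedRep.toRepresentation ρ̄ σ v = ρ̄(σ) *ᵥ v`): Ellenberg's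
"isomorphism of `𝓞`-module schemes `ι : A[3] ≅ V_{ρ̄}`" read on `K̄`-points (for the étale
group schemes `A[3]`, `V_{ρ̄}` over `K` this is the same as an isomorphism of `Γ_K`-modules).
NOT included: Ellenberg's symplectic normalisation `∧² ι = id` (no Weil pairing for abelian
varieties in the tree) — this structure is WIDER than a point of `X^{ρ̄}` by the finitely many
possible values of `∧² ι`. [cite: Ellenberg2005, §2 (definition of 𝒳^ρ̄) and Notation (V_ρ̄)] -/
structure LevelStructure (A : HilbertBlumenthalAV K F) (𝔞 : Ideal (𝓞 F)) (e : (𝓞 F ⧸ 𝔞) ≃+* k)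
    (ρ : ModPGaloisRep K k 2) where
  /-- The underlying isomorphism of abelian groups `A[𝔞] ≃ k²`. -/
  toAddEquiv : A.torsionAt 𝔞 ≃+ (Fin 2 → k)
  /-- `ι` is semilinear along `e : 𝓞 F ⧸ 𝔞 ≃+* k`. -/
  map_smul : ∀ (c : 𝓞 F ⧸ 𝔞) (P : A.torsionAt 𝔞), toAddEquiv (c • P) = e c • toAddEquiv P
  /-- `ι` is `Γ_K`-equivariant: `ι (σ • P) = ρ̄(σ) *ᵥ ι P`. -/
  map_galois : ∀ (σ : Field.absoluteGaloisGroup K) (P : A.torsionAt 𝔞),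
    toAddEquiv (σ • P) = FramedRep.toRepresentation ρ σ (toAddEquiv P)

namespace LevelStructure

variable {A : HilbertBlumenthalAV K F} {𝔞 : Ideal (𝓞 F)} {e : (𝓞 F ⧸ 𝔞) ≃+* k}
  {ρ : ModPGaloisRep K k 2} (ι : A.LevelStructure 𝔞 e ρ)

/-- Equivariance in matrix form: `ι (σ • P) = ρ̄(σ) *ᵥ ι P`. [folklore] -/
theorem map_galois_eq_mulVec (σ : Field.absoluteGaloisGroup K) (P : A.torsionAt 𝔞) :
    ι.toAddEquiv (σ • P) = ((ρ σ : GL (Fin 2) k) : Matrix (Fin 2) (Fin 2) k).mulVec (ι.toAddEquiv P) :=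
  ι.map_galois σ P

/-- A level structure intertwines the `𝔞`-torsion representation `ρ̄_{A,𝔞}` with `ρ̄`:
`ι ∘ ρ̄_{A,𝔞}(σ) = ρ̄(σ) ∘ ι` on `A[𝔞]`. [cite: Ellenberg2005, §2] -/
theorem toAddEquiv_torsionRep (σ : Field.absoluteGaloisGroup K) (P : A.torsionAt 𝔞) :
    ι.toAddEquiv (A.torsionRep 𝔞 σ P) = FramedRep.toRepresentation ρ σ (ι.toAddEquiv P) := by
  rw [torsionRep_apply_apply, ι.map_galois]

/-- With a full level-`𝔞` structure, `A[𝔞]` has exactly `|k| ^ 2` points (`= N(𝔞)²`; e.g.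
`|A[3]| = 81`, `|A[√5]| = 25` for `F = ℚ(√5)`). [folklore] -/
theorem natCard_torsionAt_eq [Finite k] (ι : A.LevelStructure 𝔞 e ρ) :
    Nat.card (A.torsionAt 𝔞) = Nat.card k ^ 2 := by
  rw [Nat.card_congr ι.toAddEquiv.toEquiv, Nat.card_fun, Nat.card_eq_fintype_card (α := Fin 2),
    Fintype.card_fin]

end LevelStructure

end HilbertBlumenthalAV

section Moduli

variable (K : Type u) [Field K] (F : Type v) [Field F] [NumberField F] [NumberField.IsTotallyReal F]
variable {k : Type w} [Field k] [TopologicalSpace k]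

/-- The `K`-points of the **twisted full-level-`𝔞` moduli problem** for HBAVs with real
multiplication by `𝓞 F`: pairs `(A, ι)` of an HBAV `A / K` and a full level-`𝔞` structure
`ι : A[𝔞] ≅ V_{ρ̄}` of type `ρ̄ : Γ_K → GL₂(k)` (along `e : 𝓞 F ⧸ 𝔞 ≃+* k`). For `𝔞 = (3)`,
`F = ℚ(√5)` see `HilbertBlumenthalLevelThreeModuli`. As for `LevelStructure`, the symplectic
condition `∧² ι = id` is NOT imposed (wider than Ellenberg's `X^{ρ̄}(K)` by the twists
`X^{ρ̄,λ}`), and only genuine abelian varieties occur (no cusps / generalized HBAVs).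
[cite: Ellenberg2005, §2 (definition of 𝒳^ρ̄ and X^ρ̄/K)] -/
structure HilbertBlumenthalLevelModuli (𝔞 : Ideal (𝓞 F)) (e : (𝓞 F ⧸ 𝔞) ≃+* k)
    (ρ : ModPGaloisRep K k 2) where
  /-- The HBAV `A / K`. -/
  av : HilbertBlumenthalAV K F
  /-- The level structure `ι : A[𝔞] ≅ V_{ρ̄}`. -/
  level : av.LevelStructure 𝔞 e ρ

/-- **Ellenberg's twisted level-`3` moduli problem `X^{ρ̄}(K)`** (requested notion): `K`-points
`(A, ι)` with `A / K` an HBAV with real multiplication by `𝓞 F` and `ι : A[3] ≅ V_{ρ̄}` a full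
level-`3` structure of type `ρ̄ : Γ_K → GL₂(k)` along `e : 𝓞 F ⧸ 3 ≃+* k`. Intended case:
`F = ℚ(√5)` (`3` inert, `𝓞/3 ≅ 𝔽₉ = k`), `det ρ̄ = χ̄₃` (`ModPGaloisRep.HasCyclotomicDet ρ̄ 3 ι`).
Ellenberg: "there exists a proper scheme `𝒳^{ρ̄}/ℤ[1/N]` parametrizing pairs `(A, ι)`, where `A`
is a generalized HBAV and `ι : A[3] ≅ V_{ρ̄}` is an isomorphism of group schemes such that
`∧² ι` is the identity map. Write `X^{ρ̄}/K` for the restriction of `𝒳^{ρ̄}` to `Spec K`."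
Here: genuine HBAVs only, and WITHOUT the condition on `∧² ι` (see the module docstring).
[cite: Ellenberg2005, §2 (definition of 𝒳^ρ̄ and X^ρ̄/K)] -/
abbrev HilbertBlumenthalLevelThreeModuli (e : (𝓞 F ⧸ Ideal.span {(3 : 𝓞 F)}) ≃+* k)
    (ρ : ModPGaloisRep K k 2) :=
  HilbertBlumenthalLevelModuli K F (Ideal.span {(3 : 𝓞 F)}) e ρ

variable {K F}

/-- A point `(A, ι)` of the twisted moduli problem realises `ρ̄` on the `𝔞`-torsion of `A`:
`ι` intertwines `ρ̄_{A,𝔞}` and `ρ̄` ("`ρ̄` as the Galois representation on the `3`-torsion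
subscheme of a certain HBAV"). [cite: Ellenberg2005, Introduction and §2] -/
theorem HilbertBlumenthalLevelModuli.toAddEquiv_torsionRep {𝔞 : Ideal (𝓞 F)}
    {e : (𝓞 F ⧸ 𝔞) ≃+* k} {ρ : ModPGaloisRep K k 2} (x : HilbertBlumenthalLevelModuli K F 𝔞 e ρ)
    (σ : Field.absoluteGaloisGroup K) (P : x.av.torsionAt 𝔞) :
    x.level.toAddEquiv (x.av.torsionRep 𝔞 σ P) = FramedRep.toRepresentation ρ σ (x.level.toAddEquiv P) :=
  x.level.toAddEquiv_torsionRep σ P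

end Moduli

/-! ### `D_v`-distinguished mod `p` representations (Ellenberg, Def. 1.1) -/

section Distinguished

variable {K : Type u} [Field K] [NumberField K] {k : Type w} [Field k] [TopologicalSpace k]
  [IsTopologicalRing k]

/-- **`D_v`-distinguished** (Ellenberg, Def. 1.1). A mod `p` representation `ρ̄ : Γ_K → GL₂(k)`
of the number field `K` is `D_v`-distinguished at the finite place `v` if, in some frame
`P ∈ GL₂(k)`, the restriction of `P ρ̄ P⁻¹` to the decomposition group `D_v` (the image of
`absGaloisRestrict K K_v : Γ_{K_v} → Γ_K`, `K_v = v.adicCompletion K`, the convention of the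
tree's `IsPDistinguishedAt`) is upper triangular — so that `(ρ̄|_{D_v})^{ss} = θ₁ ⊕ θ₂` with
`θ₁, θ₂ : D_v → kˣ` its diagonal characters — and `θ₁ ≠ θ₂`. Printed form: "the
semisimplification of the restriction to `D_𝔭` is isomorphic to `θ₁ ⊕ θ₂` with `θ₁` and `θ₂`
distinct characters", over `k = 𝔽̄_p`; for algebraically closed `k` the two formulations agree
(a plane representation with one-dimensional Jordan–Hölder factors has an invariant line), for
general `k` this one asks for the triangularisation over `k` itself. [cite: Ellenberg2005, Def. 1.1] -/
def _root_.Literature.NumberTheory.GaloisRepresentations.ModPGaloisRep.IsDistinguishedAt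
    (ρ : ModPGaloisRep K k 2) (v : HeightOneSpectrum (𝓞 K)) : Prop :=
  ∃ P : GL (Fin 2) k,
    (∀ σ : Field.absoluteGaloisGroup (v.adicCompletion K),
      ((FramedRep.conj P ρ (absGaloisRestrict K (v.adicCompletion K) σ) : GL (Fin 2) k) :
        Matrix (Fin 2) (Fin 2) k) 1 0 = 0) ∧
    ∃ σ : Field.absoluteGaloisGroup (v.adicCompletion K),
      ((FramedRep.conj P ρ (absGaloisRestrict K (v.adicCompletion K) σ) : GL (Fin 2) k) :
        Matrix (Fin 2) (Fin 2) k) 0 0 ≠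
      ((FramedRep.conj P ρ (absGaloisRestrict K (v.adicCompletion K) σ) : GL (Fin 2) k) :
        Matrix (Fin 2) (Fin 2) k) 1 1

/-- Unfolding of `IsDistinguishedAt` with the conjugation written out: `P ρ̄(σ) P⁻¹` is upper
triangular on `D_v` with somewhere-different diagonal entries. [folklore] -/
theorem _root_.Literature.NumberTheory.GaloisRepresentations.ModPGaloisRep.isDistinguishedAt_iff
    (ρ : ModPGaloisRep K k 2) (v : HeightOneSpectrum (𝓞 K)) :
    ρ.IsDistinguishedAt v ↔ ∃ P : GL (Fin 2) k,
      (∀ σ : Field.absoluteGaloisGroup (v.adicCompletion K),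
        ((P * ρ (absGaloisRestrict K (v.adicCompletion K) σ) * P⁻¹ : GL (Fin 2) k) :
          Matrix (Fin 2) (Fin 2) k) 1 0 = 0) ∧
      ∃ σ : Field.absoluteGaloisGroup (v.adicCompletion K),
        ((P * ρ (absGaloisRestrict K (v.adicCompletion K) σ) * P⁻¹ : GL (Fin 2) k) :
          Matrix (Fin 2) (Fin 2) k) 0 0 ≠
        ((P * ρ (absGaloisRestrict K (v.adicCompletion K) σ) * P⁻¹ : GL (Fin 2) k) :
          Matrix (Fin 2) (Fin 2) k) 1 1 := by
  simp only [ModPGaloisRep.IsDistinguishedAt, FramedRep.conj_apply]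

end Distinguished

/-! ### Good reduction of an HBAV at a finite place -/

namespace HilbertBlumenthalAV

variable {K : Type} [Field K] [NumberField K] {F : Type v} [Field F] [NumberField F]
  [NumberField.IsTotallyReal F]

/-- An HBAV `A` over the number field `K` has **good reduction at the finite place `v`** if its
underlying variety has a smooth proper model of relative dimension `dim A` over the local ring
`𝓞_{K,v}`: the tree's `Literature.AlgebraicGeometry.Motives.HasGoodReductionAt A.X A.dim v`
(for abelian varieties such a model is an abelian scheme, i.e. this is good reduction in the
sense of Serre–Tate, §1). [cite: SerreTate1968, §1] -/
abbrev HasGoodReductionAt (A : HilbertBlumenthalAV K F) (v : HeightOneSpectrum (𝓞 K)) : Prop :=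
  Literature.AlgebraicGeometry.Motives.HasGoodReductionAt A.X A.dim v

end HilbertBlumenthalAV

end Literature.NumberTheory.DiophantineGeometry
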